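import Summits.AtomisticToContinuum.HydrodynamicLimit.Theorems.CollisionIsometryCLTAdaptedWeightCLTTLColumnDepolarisationPieces
import Summits.AtomisticToContinuum.HydrodynamicLimit.Theorems.CollisionIsometryCLTAdaptedWeightCLTTLPastDampingAlgebra

/-!
# Stub `stub_pastDamping` of the line `contact-source-duhamel` — helper file: CARRIER MASSES of the
incoherent transport (crux `CollisionIsometryCLT.AdaptedWeightCLT`, stmt-AtomisticToContinuum-14868,
`--supports`)

PAST reads the transported one-site powers `𝒯(δ_k a^{⊗r})_i` CARRIER BY CARRIER (weighted by the block
weights `w_i`, `PastDamping.pastF_eq_sum_sites`), not only summed into clouds. This file turns the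
piece representation of `…TLColumnDepolarisationPieces.lean` (`ColumnDepolarisation.pieceCar/pieceVec`,
`tTransport_single_tpow`, `pieces_energy`, `norm_pieceVec_le`, imported) into the carrier-level
bounds the PAST estimate consumes:

* the pieces are LINEAR in the impulse (`pieceVec_add/_smul`, `pieceL`);
* pairings of powers are powers of inner products (`pairT_tpow_tpow`), so a sum of powers of pieces
  has `‖Σ b^{⊗2}‖² ≤ (Σ ‖b‖²)²` and, for pieces of norm `≤ M`, `‖Σ b^{⊗3}‖² ≤ M² (Σ ‖b‖²)²`;
* with the MASS `massAt … k a i := tr 𝒯(δ_k a⊗a)_i = Σ_{car w = i} ‖vec w‖² ≥ 0`: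
  `‖𝒯(δ_k a⊗a)_i‖² ≤ massAt²`, `‖𝒯(δ_k a^{⊗3})_i‖² ≤ ‖a‖² massAt²` (`massAt_bounds`), the column sums
  `Σ_i massAt_i = ‖a‖²` (`sum_massAt`), and `massAt … k a i ≤ ‖a‖² Σ_c massAt … k e_c i`
  (`massAt_le_basis`, Cauchy–Schwarz through the linear pieces) — so every carrier weight of PAST is
  `|y_k|² ω_{ik}` with the basis masses `ω_{ik} = Σ_c massAt … k e_c i`, whose ROW sums are `3`
  (`…TLPastDampingStochastic.lean`).
-/

namespace Summit.AtomisticToContinuum.HydrodynamicLimit.Theorems.ContactSourceDuhamel.TimeLocal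
namespace PastDamping

open scoped BigOperators Topology Classical MeasureTheory ENNReal InnerProductSpace
open Filter Set MeasureTheory
open Duhamel
open Summit.AtomisticToContinuum.HydrodynamicLimit.Theorems.AdaptedWeightCLTNegative
open ColumnDepolarisation (pieceCar pieceVec childVec tTransport_single_tpow pieces_energy
  norm_pieceVec_le)

noncomputable section

variable {σ : ℝ} {N : ℕ} {y : Cfg N} {r : ℕ}

/-! ## The pieces are linear in the impulse -/

/-- The normal projection `P = projV n` as a linear map. -/
def projL (n : V3) : V3 →ₗ[ℝ] V3 where
  toFun := projV n
  map_add' a b := by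
    simp only [projV, inner_add_right, add_div, add_smul]
  map_smul' c a := by
    simp only [projV, real_inner_smul_right, RingHom.id_apply, mul_div_assoc, smul_smul]

/-- `projL n` acts as `projV n`. -/
@[simp] theorem projL_apply (n a : V3) : projL n a = projV n a := rfl

/-- `P` is additive. -/
theorem projV_add (n a b : V3) : projV n (a + b) = projV n a + projV n b := (projL n).map_add a b

/-- `P` is homogeneous. -/
theorem projV_smul (n : V3) (c : ℝ) (a : V3) : projV n (c • a) = c • projV n a :=
  (projL n).map_smul c a

/-- `Q` is additive. -/
theorem coprojV_add (n a b : V3) : coprojV n (a + b) = coprojV n a + coprojV n b := by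
  simp only [coprojV, projV_add]; abel

/-- `Q` is homogeneous. -/
theorem coprojV_smul (n : V3) (c : ℝ) (a : V3) : coprojV n (c • a) = c • coprojV n a := by
  simp only [coprojV, projV_smul, smul_sub]

/-- A child vector is additive in the parent. -/
theorem childVec_add (k : ℕ) (c : Fin (N + 1)) (m m' : V3) (b : Bool) :
    childVec σ N y k c (m + m') b = childVec σ N y k c m b + childVec σ N y k c m' b := by
  rcases h : stepPair σ N y k with _ | pq
  · cases b <;> simp [childVec, h]
  · by_cases hc : c = pq.1 ∨ c = pq.2
    · cases b <;> simp [childVec, h, hc, projV_add, coprojV_add]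
    · cases b <;> simp [childVec, h, hc]

/-- A child vector is homogeneous in the parent. -/
theorem childVec_smul (k : ℕ) (c : Fin (N + 1)) (t : ℝ) (m : V3) (b : Bool) :
    childVec σ N y k c (t • m) b = t • childVec σ N y k c m b := by
  rcases h : stepPair σ N y k with _ | pq
  · cases b <;> simp [childVec, h]
  · by_cases hc : c = pq.1 ∨ c = pq.2
    · cases b <;> simp [childVec, h, hc, projV_smul, coprojV_smul]
    · cases b <;> simp [childVec, h, hc]

/-- **The pieces are additive in the impulse.** -/
theorem pieceVec_add (k : Fin (N + 1)) (a a' : V3) (m : ℕ) (w : Fin m → Bool) :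
    pieceVec σ N y k (a + a') m w = pieceVec σ N y k a m w + pieceVec σ N y k a' m w := by
  induction m with
  | zero => rfl
  | succ m ih => simp only [pieceVec, ih, childVec_add]

/-- **The pieces are homogeneous in the impulse.** -/
theorem pieceVec_smul (k : Fin (N + 1)) (t : ℝ) (a : V3) (m : ℕ) (w : Fin m → Bool) :
    pieceVec σ N y k (t • a) m w = t • pieceVec σ N y k a m w := by
  induction m with
  | zero => rfl
  | succ m ih => simp only [pieceVec, ih, childVec_smul]

/-- The piece with history `w` as a LINEAR map of the impulse. -/
def pieceL (σ : ℝ) (N : ℕ) (y : Cfg N) (k : Fin (N + 1)) (m : ℕ) (w : Fin m → Bool) :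
    V3 →ₗ[ℝ] V3 where
  toFun a := pieceVec σ N y k a m w
  map_add' a a' := pieceVec_add k a a' m w
  map_smul' t a := pieceVec_smul k t a m w

/-- `pieceL` evaluates to `pieceVec`. -/
@[simp] theorem pieceL_apply (k : Fin (N + 1)) (m : ℕ) (w : Fin m → Bool) (a : V3) :
    pieceL σ N y k m w a = pieceVec σ N y k a m w := rfl

/-! ## Traces and pairings of powers -/

/-- The trace of a rank-2 tensor. -/
def trT (T : Tens 2) : ℝ := ∑ c : Fin 3, T ![c, c]

/-- `trT` is additive. -/
theorem trT_add (A B : Tens 2) : trT (A + B) = trT A + trT B := by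
  simp only [trT, Pi.add_apply, Finset.sum_add_distrib]

/-- `trT 0 = 0`. -/
theorem trT_zero : trT (0 : Tens 2) = 0 := by
  simp [trT]

/-- `trT` commutes with finite sums. -/
theorem trT_sum {ι : Type*} (s : Finset ι) (A : ι → Tens 2) :
    trT (∑ l ∈ s, A l) = ∑ l ∈ s, trT (A l) :=
  map_sum (⟨⟨trT, trT_zero⟩, trT_add⟩ : Tens 2 →+ ℝ) A s

/-- `tr (b ⊗ b) = ‖b‖²`. -/
theorem trT_tpow_two (b : V3) : trT (tpow 2 b) = ‖b‖ ^ 2 := by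
  rw [trT, EuclideanSpace.real_norm_sq_eq]
  refine Finset.sum_congr rfl fun c _ => ?_
  rw [tpow_two_apply]
  simp [pow_two]

/-- `tr Σ_α b_α ⊗ b_α = Σ_α ‖b_α‖²`. -/
theorem trT_sum_tpow_two {ι : Type*} (s : Finset ι) (b : ι → V3) :
    trT (∑ α ∈ s, tpow 2 (b α)) = ∑ α ∈ s, ‖b α‖ ^ 2 := by
  rw [trT_sum]
  exact Finset.sum_congr rfl fun α _ => trT_tpow_two (b α)

/-- The pairing is symmetric. -/
theorem pairT_comm (A B : Tens r) : pairT A B = pairT B A := by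
  simp only [pairT, mul_comm]

/-- **Pairings of powers are powers of inner products**: `⟨u^{⊗r}, v^{⊗r}⟩ = ⟪u, v⟫^r`. -/
theorem pairT_tpow_tpow (u v : V3) : pairT (tpow r u) (tpow r v) = ⟪u, v⟫_ℝ ^ r := by
  rw [inner_eq_sum, pairT]
  have h : ∀ idx : Fin r → Fin 3, tpow r u idx * tpow r v idx = ∏ s, (u (idx s) * v (idx s)) := by
    intro idx
    rw [tpow, tpow, ← Finset.prod_mul_distrib]
  simp only [h]
  rw [← Fintype.prod_sum (fun (_ : Fin r) (c : Fin 3) => u c * v c)]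
  simp

/-- `⟪u, v⟫² ≤ ‖u‖² ‖v‖²`. -/
theorem inner_sq_le (u v : V3) : ⟪u, v⟫_ℝ ^ 2 ≤ ‖u‖ ^ 2 * ‖v‖ ^ 2 := by
  rw [← mul_pow, ← sq_abs]
  exact pow_le_pow_left₀ (abs_nonneg _) (abs_real_inner_le_norm u v) 2

/-- `⟪u, v⟫³ ≤ ‖u‖³ ‖v‖³`. -/
theorem inner_cube_le (u v : V3) : ⟪u, v⟫_ℝ ^ 3 ≤ ‖u‖ ^ 3 * ‖v‖ ^ 3 := by
  rw [← mul_pow]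
  calc ⟪u, v⟫_ℝ ^ 3 ≤ |⟪u, v⟫_ℝ ^ 3| := le_abs_self _
    _ = |⟪u, v⟫_ℝ| ^ 3 := abs_pow _ 3
    _ ≤ (‖u‖ * ‖v‖) ^ 3 := pow_le_pow_left₀ (abs_nonneg _) (abs_real_inner_le_norm u v) 3

/-- **Rank 2**: `‖Σ_α b_α^{⊗2}‖² ≤ (Σ_α ‖b_α‖²)²`. -/
theorem normSqT_sum_tpow_two_le {ι : Type*} (s : Finset ι) (b : ι → V3) :
    normSqT (∑ α ∈ s, tpow 2 (b α)) ≤ (∑ α ∈ s, ‖b α‖ ^ 2) ^ 2 := by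
  have h0 : normSqT (∑ α ∈ s, tpow 2 (b α)) = pairT (∑ α ∈ s, tpow 2 (b α)) (∑ α ∈ s, tpow 2 (b α)) := by
    simp only [normSqT, pairT, pow_two]
  rw [h0, pairT_sum_right]
  simp_rw [pairT_comm _ (tpow 2 (b _)), pairT_sum_right, pairT_tpow_tpow]
  rw [pow_two, Finset.sum_mul_sum]
  exact Finset.sum_le_sum fun α _ => Finset.sum_le_sum fun β _ => inner_sq_le (b α) (b β)

/-- **Rank 3**: for pieces of norm `≤ M`, `‖Σ_α b_α^{⊗3}‖² ≤ M² (Σ_α ‖b_α‖²)²`. -/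
theorem normSqT_sum_tpow_three_le {ι : Type*} (s : Finset ι) (b : ι → V3) {M : ℝ}
    (hM : ∀ α ∈ s, ‖b α‖ ≤ M) :
    normSqT (∑ α ∈ s, tpow 3 (b α)) ≤ M ^ 2 * (∑ α ∈ s, ‖b α‖ ^ 2) ^ 2 := by
  have h0 : normSqT (∑ α ∈ s, tpow 3 (b α)) = pairT (∑ α ∈ s, tpow 3 (b α)) (∑ α ∈ s, tpow 3 (b α)) := by
    simp only [normSqT, pairT, pow_two]
  rw [h0, pairT_sum_right]
  simp_rw [pairT_comm _ (tpow 3 (b _)), pairT_sum_right, pairT_tpow_tpow]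
  have h3 : ∀ α ∈ s, ‖b α‖ ^ 3 ≤ M * ‖b α‖ ^ 2 := by
    intro α hα
    rw [show ‖b α‖ ^ 3 = ‖b α‖ * ‖b α‖ ^ 2 by ring]
    exact mul_le_mul_of_nonneg_right (hM α hα) (sq_nonneg _)
  calc ∑ α ∈ s, ∑ β ∈ s, ⟪b α, b β⟫_ℝ ^ 3
      ≤ ∑ α ∈ s, ∑ β ∈ s, ‖b α‖ ^ 3 * ‖b β‖ ^ 3 :=
        Finset.sum_le_sum fun α _ => Finset.sum_le_sum fun β _ => inner_cube_le (b α) (b β)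
    _ = (∑ α ∈ s, ‖b α‖ ^ 3) ^ 2 := by rw [pow_two, Finset.sum_mul_sum]
    _ ≤ (M * ∑ α ∈ s, ‖b α‖ ^ 2) ^ 2 := by
        refine pow_le_pow_left₀ (Finset.sum_nonneg fun α _ => pow_nonneg (norm_nonneg _) 3) ?_ 2
        rw [Finset.mul_sum]
        exact Finset.sum_le_sum h3
    _ = M ^ 2 * (∑ α ∈ s, ‖b α‖ ^ 2) ^ 2 := by ring

/-! ## The one-site transport, carrier by carrier -/

/-- **Carrier-resolved piece representation** (`r ≥ 1`): the one-site transport on carrier `i` is the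
sum of the powers of the pieces that sit on `i`. -/
theorem oneSite_eq_sum_filter (hr : 0 < r) (m : ℕ) (k i : Fin (N + 1)) (a : V3) :
    tTransport r σ N y 0 m (Pi.single k (tpow r a)) i =
      ∑ w ∈ Finset.univ.filter (fun w : Fin m → Bool => i = pieceCar σ N y k m w),
        tpow r (pieceVec σ N y k a m w) := by
  rw [tTransport_single_tpow hr, Finset.sum_apply, Finset.sum_filter]
  exact Finset.sum_congr rfl fun w _ => by rw [Pi.single_apply]

/-- The MASS of the rank-2 one-site transport of `a ⊗ a` from site `k` sitting on carrier `i` after the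
first `m` fold steps: `tr 𝒯(δ_k a⊗a)_i` (`= Σ_{car w = i} ‖vec w‖²` in pieces, `massAt_eq`). -/
def massAt (σ : ℝ) (N : ℕ) (y : Cfg N) (m : ℕ) (k : Fin (N + 1)) (a : V3) (i : Fin (N + 1)) : ℝ :=
  trT (tTransport 2 σ N y 0 m (Pi.single k (tpow 2 a)) i)

/-- The mass in pieces. -/
theorem massAt_eq (m : ℕ) (k : Fin (N + 1)) (a : V3) (i : Fin (N + 1)) :
    massAt σ N y m k a i = ∑ w ∈ Finset.univ.filter (fun w : Fin m → Bool => i = pieceCar σ N y k m w),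
      ‖pieceVec σ N y k a m w‖ ^ 2 := by
  rw [massAt, oneSite_eq_sum_filter two_pos, trT_sum_tpow_two]

/-- **Carrier-level bounds.** The mass is non-negative and controls both one-site transports on the
carrier: `‖𝒯(δ_k a⊗a)_i‖² ≤ massAt²`, `‖𝒯(δ_k a^{⊗3})_i‖² ≤ ‖a‖² massAt²`. -/
theorem massAt_bounds (σ : ℝ) (N : ℕ) (y : Cfg N) (m : ℕ) (k : Fin (N + 1)) (a : V3)
    (i : Fin (N + 1)) :
    0 ≤ massAt σ N y m k a i ∧
      normSqT (tTransport 2 σ N y 0 m (Pi.single k (tpow 2 a)) i) ≤ massAt σ N y m k a i ^ 2 ∧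
      normSqT (tTransport 3 σ N y 0 m (Pi.single k (tpow 3 a)) i) ≤
        ‖a‖ ^ 2 * massAt σ N y m k a i ^ 2 := by
  refine ⟨?_, ?_, ?_⟩
  · rw [massAt_eq]
    exact Finset.sum_nonneg fun w _ => sq_nonneg _
  · rw [massAt_eq, oneSite_eq_sum_filter two_pos]
    exact normSqT_sum_tpow_two_le _ _
  · rw [massAt_eq, oneSite_eq_sum_filter three_pos]
    exact normSqT_sum_tpow_three_le _ _ fun w _ => norm_pieceVec_le k a m w

/-- **Column sums**: the masses of one site add up to the injected energy, `Σ_i massAt_i = ‖a‖²`. -/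
theorem sum_massAt (σ : ℝ) (N : ℕ) (y : Cfg N) (m : ℕ) (k : Fin (N + 1)) (a : V3) :
    ∑ i, massAt σ N y m k a i = ‖a‖ ^ 2 := by
  simp only [massAt_eq, Finset.sum_filter]
  rw [Finset.sum_comm, ← pieces_energy (σ := σ) (y := y) k a m]
  exact Finset.sum_congr rfl fun w _ => by rw [Finset.sum_ite_eq']; simp

/-- Every impulse is the combination of the basis impulses with its coordinates. -/
theorem eq_sum_coord_smul_baseV (a : V3) : a = ∑ c : Fin 3, a c • baseV c := by
  have h := (EuclideanSpace.basisFun (Fin 3) ℝ).sum_repr a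
  conv_lhs => rw [← h]
  refine Finset.sum_congr rfl fun c _ => ?_
  rw [EuclideanSpace.basisFun_apply]
  rfl

/-- A linear map on `ℝ³` is controlled by its values on the basis:
`‖L a‖² ≤ ‖a‖² Σ_c ‖L e_c‖²` (Cauchy–Schwarz). -/
theorem norm_sq_linear_le (L : V3 →ₗ[ℝ] V3) (a : V3) :
    ‖L a‖ ^ 2 ≤ ‖a‖ ^ 2 * ∑ c : Fin 3, ‖L (baseV c)‖ ^ 2 := by
  have hrepr : L a = ∑ c : Fin 3, a c • L (baseV c) := by
    conv_lhs => rw [eq_sum_coord_smul_baseV a]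
    simp only [map_sum, map_smul]
  have hnorm : ‖L a‖ ≤ ∑ c : Fin 3, |a c| * ‖L (baseV c)‖ := by
    rw [hrepr]
    refine (norm_sum_le _ _).trans (le_of_eq ?_)
    exact Finset.sum_congr rfl fun c _ => by rw [norm_smul, Real.norm_eq_abs]
  have hcs := Finset.sum_mul_sq_le_sq_mul_sq Finset.univ (fun c : Fin 3 => |a c|)
    (fun c => ‖L (baseV c)‖)
  have hsq : ∑ c : Fin 3, |a c| ^ 2 = ‖a‖ ^ 2 := by
    rw [EuclideanSpace.real_norm_sq_eq]
    exact Finset.sum_congr rfl fun c _ => sq_abs _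
  rw [hsq] at hcs
  calc ‖L a‖ ^ 2 ≤ (∑ c : Fin 3, |a c| * ‖L (baseV c)‖) ^ 2 :=
        pow_le_pow_left₀ (norm_nonneg _) hnorm 2
    _ ≤ ‖a‖ ^ 2 * ∑ c : Fin 3, ‖L (baseV c)‖ ^ 2 := hcs

/-- **Masses are controlled by basis masses**: `massAt … k a i ≤ ‖a‖² Σ_c massAt … k e_c i` (the
pieces are linear; Cauchy–Schwarz on `a = Σ_c a_c e_c`). -/
theorem massAt_le_basis (σ : ℝ) (N : ℕ) (y : Cfg N) (m : ℕ) (k : Fin (N + 1)) (a : V3)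
    (i : Fin (N + 1)) :
    massAt σ N y m k a i ≤ ‖a‖ ^ 2 * ∑ c : Fin 3, massAt σ N y m k (baseV c) i := by
  simp only [massAt_eq]
  rw [Finset.sum_comm, Finset.mul_sum]
  refine Finset.sum_le_sum fun w _ => ?_
  have h := norm_sq_linear_le (pieceL σ N y k m w) a
  simpa only [pieceL_apply] using h

/-- Registered anchor of this helper file (the column sums `sum_massAt`, with `massAt` and `trT`
unfolded). -/
theorem pastDamping_masses_anchor : ∀ (σ : ℝ) (N : ℕ) (y : Cfg N) (m : ℕ) (k : Fin (N + 1)) (a : V3), ∑ i : Fin (N + 1), ∑ d : Fin 3, tTransport 2 σ N y 0 m (Pi.single k (tpow 2 a)) i ![d, d] = ‖a‖ ^ 2 :=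
  sum_massAt

/-! ## The basis carrier masses `ω` (appended for the v2 locality estimate) -/

/-- The BASIS CARRIER MASS `ω_{ki}(m) = Σ_c massAt … m k e_c i = tr 𝒯(δ_k 𝟙)_i`: the share of the
identity tensor injected at `k` that sits on carrier `i` after `m` fold steps (column sums `3` here;
row sums `3` by the double stochasticity of the transport, `…TLPastDampingDecomposition.lean`). -/
def omegaAt (σ : ℝ) (N : ℕ) (y : Cfg N) (m : ℕ) (k i : Fin (N + 1)) : ℝ :=
  ∑ c : Fin 3, massAt σ N y m k (baseV c) i

/-- `‖e_c‖ = 1`. -/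
theorem norm_baseV (c : Fin 3) : ‖baseV c‖ = 1 := by
  rw [baseV, EuclideanSpace.single, PiLp.norm_single, norm_one]

/-- `ω ≥ 0`. -/
theorem omegaAt_nonneg (m : ℕ) (k i : Fin (N + 1)) : 0 ≤ omegaAt σ N y m k i :=
  Finset.sum_nonneg fun c _ => (massAt_bounds σ N y m k (baseV c) i).1

/-- COLUMN SUMS: `Σ_i ω_{ki} = 3`. -/
theorem sum_carriers_omegaAt (m : ℕ) (k : Fin (N + 1)) : ∑ i, omegaAt σ N y m k i = 3 := by
  unfold omegaAt
  rw [Finset.sum_comm]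
  simp only [sum_massAt, norm_baseV, one_pow, Finset.sum_const, Finset.card_univ, Fintype.card_fin,
    nsmul_eq_mul, Nat.cast_ofNat, mul_one]

/-- Masses are controlled by the basis masses: `massAt … k a i ≤ ‖a‖² ω_{ki}`. -/
theorem massAt_le_omegaAt (m : ℕ) (k : Fin (N + 1)) (a : V3) (i : Fin (N + 1)) :
    massAt σ N y m k a i ≤ ‖a‖ ^ 2 * omegaAt σ N y m k i :=
  massAt_le_basis σ N y m k a i

end

end PastDamping
end Summit.AtomisticToContinuum.HydrodynamicLimit.Theorems.ContactSourceDuhamel.TimeLocal
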